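import Summits.Parity.GeneralizedHardyLittlewood.Theorems.LeeYangFibresModelHyperbolicityDefs
import Summits.Parity.GeneralizedHardyLittlewood.Theorems.ModelHyperbolicity.Negative.ModelHyperbolicityNotMonotone
import HarnessLib

/-!
# Route `LeeYangFibres`, crux `ModelHyperbolicity` (stmt-Parity-14110), line `window-chain-transport`:
# the finite-`x` TRANSFER `stub_transfer : TransferStep`

With the vocabulary of `Theorems/LeeYangFibresModelHyperbolicityDefs` (`modelPoly u = Σ_{j<u} I_{j+1}(u) X^j`,
`ModelSimple u`, `CellAsymptotics u`, `TransferStep`) and the landed finite-`x` objects of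
`Theorems/ModelHyperbolicity/Negative/*` (`cell u x j = A_j(x)`, the reduced real cell polynomial
`cellPolyQ u x = Σ_{j<u} A_{j+1}(x) X^j`, `RealRootedAt u x`), we prove the registered stub

  `stub_transfer : ∀ u ≥ 2, ModelSimple u → CellAsymptotics u → ∃ x₀, ∀ x ≥ x₀, RealRootedAt u x`.

Proof. `u = 2`: `realRootedAt_two` (`x₀ = 2`, Bertrand). `u ≥ 3`, `d := u - 2 ≥ 1`, `p := modelPoly u`:
`ModelSimple u` says `deg p ≤ d ≤ #(distinct real roots of p)`, so `p ≠ 0` splits over `ℝ` with `d` simple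
roots `r_0 < ⋯ < r_{d-1}` (`Finset.orderEmbOfFin`) and `p = lead · ∏ (X - r_k)`.
(1) ALTERNATION (`tr_exists_alternating`, `tr_eval_mul_eval_neg`): with the strictly increasing test points
`t_0 = r_0 - 1`, `t_{i+1} = (r_i + r_{i+1})/2` (roots extended increasingly beyond `d`), `t_i < r_i < t_{i+1}`
and every other root lies outside `[t_i, t_{i+1}]`, so in `p(t_i) p(t_{i+1}) = lead² ∏_k (t_i - r_k)(t_{i+1} - r_k)`
exactly the factor `k = i` is negative: `p(t_i) p(t_{i+1}) < 0` for `i < d`.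
(2) LIMITS (`tr_tendsto_scaled_eval`): `(log x/x) · Q_{u,x}(s) = Σ_{j<u} (A_{j+1}(x) log x/x) s^j → p(s)`
for every fixed real `s`, by `CellAsymptotics u` (finite sum of limits).
(3) Hence `(log x/x)² Q_{u,x}(t_i) Q_{u,x}(t_{i+1}) → p(t_i) p(t_{i+1}) < 0`, so each of the `d` products
`Q_{u,x}(t_i) Q_{u,x}(t_{i+1})` is eventually negative (`(log x/x)² ≥ 0`); finitely many `i` give one `x₀(u)`
(`Finset.eventually_all`, `eventually_atTop`).
(4) For `x ≥ x₀`: strict sign alternation of `Q_{u,x}` at `d + 1` increasing points with `deg Q_{u,x} ≤ d`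
(`natDegree_cellPolyQ_le`: `A_u = 0`) gives `RealRootedAt u x` by the landed `realRootedAt_of_alternating`
(IVT root count + "as many real roots as the degree ⇒ all complex roots real").

References: line card `Cruxes/ModelHyperbolicity/Lines/window-chain-transport.md`; K. Alladi, Quart. J. Math.
Oxford (2) 33 (1982) 129–148 (the cell asymptotics, consumed here only as the hypothesis `CellAsymptotics u`).
-/

noncomputable section

namespace Summit.Parity.GeneralizedHardyLittlewood.Cruxes.ModelHyperbolicity.WindowChainTransport

open scoped BigOperators
open Polynomial Filter
open Summit.Parity.GeneralizedHardyLittlewood.Theorems.ModelHyperbolicity.Negative (cell RealRootedAt cellPolyQ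
  cellPolyQ_eval natDegree_cellPolyQ_le realRootedAt_of_alternating realRootedAt_two)

/-! ## Helper lemmas -/

/-- Core sign computation: a real polynomial with `natDegree ≤ #(distinct real roots)` splits with
simple roots, `p = lead · ∏_{b ∈ S} (X - b)`, so across a root `a` that is the only root in
`[t₁, t₂]` the values `p(t₁)`, `p(t₂)` have opposite strict signs: every other factor pair
`(t₁ - b)(t₂ - b)` is positive and `(t₁ - a)(t₂ - a) < 0`. -/
theorem tr_eval_mul_eval_neg {p : ℝ[X]} (hp : p ≠ 0)
    (hcard : p.natDegree ≤ p.roots.toFinset.card) {a t₁ t₂ : ℝ} (ha : a ∈ p.roots.toFinset)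
    (h₁ : t₁ < a) (h₂ : a < t₂) (hsep : ∀ b ∈ p.roots.toFinset, b ≠ a → b < t₁ ∨ t₂ < b) :
    p.eval t₁ * p.eval t₂ < 0 := by
  classical
  have hle1 : p.roots.toFinset.card ≤ p.roots.card := Multiset.toFinset_card_le _
  have hle2 : p.roots.card ≤ p.natDegree := card_roots' p
  have hsplit : p.roots.card = p.natDegree := le_antisymm hle2 (hcard.trans hle1)
  have hnodup : p.roots.Nodup :=
    Multiset.toFinset_card_eq_card_iff_nodup.mp (le_antisymm hle1 (hle2.trans hcard))
  have hroots : p.roots = p.roots.toFinset.val := by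
    rw [Multiset.toFinset_val, hnodup.dedup]
  have key : p = C p.leadingCoeff * (p.roots.toFinset.val.map fun b => X - C b).prod := by
    rw [← hroots]
    exact (C_leadingCoeff_mul_prod_multiset_X_sub_C hsplit).symm
  have hprod : ∀ s : ℝ, p.eval s = p.leadingCoeff * ∏ b ∈ p.roots.toFinset, (s - b) := by
    intro s
    have h := congrArg (eval s) key
    rw [eval_mul, eval_C, eval_multiset_prod, Multiset.map_map] at h
    rw [h, Finset.prod_eq_multiset_prod]
    simp only [Function.comp_def, eval_sub, eval_X, eval_C]
  have hlc : 0 < p.leadingCoeff * p.leadingCoeff := mul_self_pos.mpr (leadingCoeff_ne_zero.mpr hp)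
  rw [hprod, hprod, mul_mul_mul_comm, ← Finset.prod_mul_distrib]
  refine mul_neg_of_pos_of_neg hlc ?_
  rw [← Finset.mul_prod_erase _ _ ha]
  refine mul_neg_of_neg_of_pos (mul_neg_of_neg_of_pos (by linarith) (by linarith)) ?_
  refine Finset.prod_pos fun b hb => ?_
  obtain ⟨hba, hbS⟩ := Finset.mem_erase.mp hb
  rcases hsep b hbS hba with h | h
  · exact mul_pos (by linarith) (by linarith)
  · exact mul_pos_of_neg_of_neg (by linarith) (by linarith)

/-- ROOTS ⇒ ALTERNATION: if `natDegree p ≤ d := #(distinct real roots of p)` and `p ≠ 0`, there is a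
strictly increasing sequence of real test points `t` with `p(t_i) · p(t_{i+1}) < 0` for all `i < d`
(sort the roots `r_0 < ⋯ < r_{d-1}` by `Finset.orderEmbOfFin`, extend strictly increasingly to `ℕ`,
and take `t_0 = r_0 - 1`, `t_{i+1} = (r_i + r_{i+1})/2`, so that `t_i < r_i < t_{i+1}`). -/
theorem tr_exists_alternating {p : ℝ[X]} (hp : p ≠ 0)
    (hcard : p.natDegree ≤ p.roots.toFinset.card) :
    ∃ t : ℕ → ℝ, StrictMono t ∧
      ∀ i < p.roots.toFinset.card, p.eval (t i) * p.eval (t (i + 1)) < 0 := by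
  classical
  obtain ⟨d, hd⟩ : ∃ d, p.roots.toFinset.card = d := ⟨_, rfl⟩
  rw [hd]
  set S := p.roots.toFinset with hS
  -- the sorted roots, extended to a strictly increasing sequence `r'` on `ℕ`
  set r : Fin d ↪o ℝ := S.orderEmbOfFin hd with hr
  set M : ℝ := ∑ b ∈ S, |b| + 1 with hM
  have hrM : ∀ k : Fin d, r k < M := by
    intro k
    have h1 : |r k| ≤ ∑ b ∈ S, |b| :=
      Finset.single_le_sum (f := fun b : ℝ => |b|) (fun b _ => abs_nonneg b) (S.orderEmbOfFin_mem hd k)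
    have h2 : r k ≤ |r k| := le_abs_self _
    linarith
  let r' : ℕ → ℝ := fun k => if h : k < d then r ⟨k, h⟩ else M + k
  have hr'r : ∀ k : Fin d, r' k = r k := fun k => by simp [r']
  have hr'mono : StrictMono r' := by
    refine strictMono_nat_of_lt_succ fun k => ?_
    by_cases hk1 : k + 1 < d
    · have e1 : r' k = r ⟨k, by omega⟩ := dif_pos (by omega)
      have e2 : r' (k + 1) = r ⟨k + 1, hk1⟩ := dif_pos hk1
      rw [e1, e2]
      exact r.strictMono (Fin.mk_lt_mk.mpr (Nat.lt_succ_self k))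
    · have e2 : r' (k + 1) = M + (k + 1 : ℕ) := dif_neg hk1
      rw [e2]
      by_cases hk : k < d
      · have e1 : r' k = r ⟨k, hk⟩ := dif_pos hk
        rw [e1]
        have := hrM ⟨k, hk⟩
        have : (0 : ℝ) ≤ ((k + 1 : ℕ) : ℝ) := Nat.cast_nonneg _
        linarith
      · have e1 : r' k = M + (k : ℕ) := dif_neg hk
        rw [e1]
        push_cast
        linarith
  -- the test points
  let t : ℕ → ℝ := fun i => if i = 0 then r' 0 - 1 else (r' (i - 1) + r' i) / 2
  have ht0 : t 0 = r' 0 - 1 := rfl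
  have hts : ∀ i, t (i + 1) = (r' i + r' (i + 1)) / 2 := fun i => by
    simp [t]
  have hlt : ∀ i, t i < r' i := by
    intro i
    rcases i with _ | j
    · rw [ht0]; linarith
    · rw [hts]
      have := hr'mono (Nat.lt_succ_self j)
      linarith
  have hgt : ∀ i, r' i < t (i + 1) := by
    intro i
    rw [hts]
    have := hr'mono (Nat.lt_succ_self i)
    linarith
  have htmono : StrictMono t := strictMono_nat_of_lt_succ fun i => (hlt i).trans (hgt i)
  refine ⟨t, htmono, fun i hi => ?_⟩
  have hmem : r ⟨i, hi⟩ ∈ S := S.orderEmbOfFin_mem hd _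
  refine tr_eval_mul_eval_neg hp hcard hmem ?_ ?_ ?_
  · have := hlt i
    rwa [hr'r ⟨i, hi⟩] at this
  · have := hgt i
    rwa [hr'r ⟨i, hi⟩] at this
  · intro b hb hba
    have hb' : b ∈ Set.range r := by
      rw [hr, Finset.range_orderEmbOfFin]
      exact Finset.mem_coe.mpr hb
    obtain ⟨k, rfl⟩ := hb'
    have hki : (k : ℕ) ≠ i := fun h => hba (by congr 1; exact Fin.ext h)
    rcases lt_or_gt_of_ne hki with h | h
    · left
      calc r k = r' k := (hr'r k).symm
        _ < t (k + 1) := hgt k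
        _ ≤ t i := htmono.monotone (by omega)
    · right
      calc t (i + 1) ≤ t k := htmono.monotone (by omega)
        _ < r' k := hlt k
        _ = r k := hr'r k

/-- LIMITS: at a fixed real point `s`, the scaled reduced cell polynomial `(log x / x) · Q_{u,x}(s)`
tends to the model value `p_u(s)` (finite sum of the cell asymptotics). -/
theorem tr_tendsto_scaled_eval {u : ℕ} (hA : CellAsymptotics u) (s : ℝ) :
    Tendsto (fun x : ℕ => Real.log x / x * (cellPolyQ u x).eval s) atTop
      (nhds ((modelPoly u).eval s)) := by
  have h1 : (fun x : ℕ => Real.log x / x * (cellPolyQ u x).eval s) =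
      fun x : ℕ => ∑ j ∈ Finset.range u, (cell u x (j + 1) : ℝ) * Real.log x / x * s ^ j := by
    funext x
    rw [cellPolyQ_eval, Finset.mul_sum]
    refine Finset.sum_congr rfl fun j _ => ?_
    ring
  rw [h1, modelPoly_eval]
  exact tendsto_finsetSum _ fun j _ => (hA j).mul_const _

/-! ## The registered stub (name and statement EXACTLY as registered) -/

/-- **`stub_transfer` (registered): the finite-`x` TRANSFER.** For `u ≥ 2`, `u - 2` simple real
zeros of the model polynomial `p_u = modelPoly u` (with `deg p_u ≤ u - 2`) and Alladi's cell
asymptotics `A_{j+1}(x) log x / x → I_{j+1}(u)` give an `x₀(u)` beyond which the cell polynomial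
`P_{u,x}` has only real zeros. Proof: `u = 2` is the landed `realRootedAt_two` (`x₀ = 2`). For
`u ≥ 3`, sort the `d = u - 2` distinct roots of `p_u` and choose `d + 1` strictly increasing test
points with `p_u(t_i) p_u(t_{i+1}) < 0` (`tr_exists_alternating`); since
`(log x/x)² · Q_{u,x}(t_i) Q_{u,x}(t_{i+1}) → p_u(t_i) p_u(t_{i+1}) < 0` (`tr_tendsto_scaled_eval`),
each of the finitely many products `Q_{u,x}(t_i) Q_{u,x}(t_{i+1})` is eventually negative, whence one
`x₀`; for `x ≥ x₀` the landed `realRootedAt_of_alternating` (`deg Q_{u,x} ≤ u - 2`,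
`natDegree_cellPolyQ_le`) concludes. -/
theorem stub_transfer : TransferStep := by
  intro u hu hMS hA
  obtain ⟨hdeg, hcard⟩ := hMS
  rcases hu.eq_or_lt with rfl | hu3
  · exact ⟨2, fun x hx => realRootedAt_two x hx⟩
  have hp0 : modelPoly u ≠ 0 := by
    intro h0
    rw [h0, roots_zero, Multiset.toFinset_zero, Finset.card_empty] at hcard
    omega
  have hle1 : (modelPoly u).roots.toFinset.card ≤ (modelPoly u).roots.card :=
    Multiset.toFinset_card_le _
  have hle2 : (modelPoly u).roots.card ≤ (modelPoly u).natDegree := card_roots' _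
  have hD : (modelPoly u).roots.toFinset.card = u - 2 := by omega
  obtain ⟨t, htmono, hsign⟩ := tr_exists_alternating hp0 (hdeg.trans hcard)
  rw [hD] at hsign
  -- eventually (in `x`) the `u - 1` consecutive products of `Q_{u,x}` at the test points are negative
  have hev : ∀ i ∈ Finset.range (u - 2), ∀ᶠ x : ℕ in atTop,
      (cellPolyQ u x).eval (t i) * (cellPolyQ u x).eval (t (i + 1)) < 0 := by
    intro i hi
    have hev1 := ((tr_tendsto_scaled_eval hA (t i)).mul
      (tr_tendsto_scaled_eval hA (t (i + 1)))).eventually_lt_const (hsign i (Finset.mem_range.mp hi))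
    filter_upwards [hev1] with x hx
    have e : Real.log x / x * (cellPolyQ u x).eval (t i) *
        (Real.log x / x * (cellPolyQ u x).eval (t (i + 1))) =
        Real.log x / x * (Real.log x / x) *
          ((cellPolyQ u x).eval (t i) * (cellPolyQ u x).eval (t (i + 1))) := by
      ring
    rw [e] at hx
    exact neg_of_mul_neg_right hx (mul_self_nonneg _)
  obtain ⟨x₀, hx₀⟩ := eventually_atTop.mp ((Finset.eventually_all _).mpr hev)
  exact ⟨x₀, fun x hx => realRootedAt_of_alternating t (fun i _ => htmono (Nat.lt_succ_self i))
    (fun i hi => hx₀ x hx i (Finset.mem_range.mpr hi)) (natDegree_cellPolyQ_le u x (by omega))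
    (by omega)⟩

end Summit.Parity.GeneralizedHardyLittlewood.Cruxes.ModelHyperbolicity.WindowChainTransport

end
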